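import Summits.ResolutionOfSingularities.ResolutionOfSingularities.Theorems.FrobeniusClosingSteerChartRsopPart

/-!
# Crux `Steer` (stmt-ResolutionOfSingularities-16345) — K-TX part 4d, the TARGET of the residue-compatible transport map `Φ`:
# `A = κ(O)[Y_(u,i) : u ∈ K, i ∈ ℕ]`, the evaluation `ev : Y_(u,i) ↦ ū`, `𝔭 = ker ev`, `L = A_𝔭`, and residue-compatibility

[cite: CossartPiltant2008, §4]; folklore commutative algebra (design: seat folder `D/res-D-brk-2/HANDOFF.md`, gen 6, "4d route REFINED").

The STALE-unit case of the toric unit exit transports the final local ring `R'` of the toric tower into the local ring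
`L = κ(O)[Y]_𝔭` by a ring map `Φ` which is RESIDUE-COMPATIBLE (`ev_L ∘ Φ = residue`); then membership in the centre (resp. its square) is
carried to membership in `𝔪_L` (resp. `𝔪_L²`) and the Euler end argument `…ToricUnitExitEuler.sq_free_euler` applies.  This file sets the
target up once and for all (variables indexed by `K × ℕ` so that a FRESH variable with prescribed residue is always available) and proves the
two transport facts and the extension of a residue-compatible map along `locAtCentre` (a localisation, `isLocalization_locAtCentre`).

Contents (namespace `…Theorems.SteerToricUnitExit`):
* `resK O u` — the residue of `u ∈ K` in `κ(O)` (`0` off `O`); `resK_of_mem`;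
* `evalRes O` — the `κ(O)`-algebra map `A → κ(O)`, `Y_(u,i) ↦ resK O u`; `evalRes_X`;
* `kerRes O = ker (evalRes O)`, `kerRes_isPrime` (a theorem; use `haveI`), `X_not_mem_kerRes`; `evalResL`, `evalResL_algebraMap`, `mem_maximalIdeal_iff_evalResL`;
* `ResCompat O R h Φ` — residue-compatibility of `Φ : R →+* Localization.AtPrime (kerRes O)`;
* `ResCompat.mem_centre_iff`, `ResCompat.map_mem_sq` — transport of the centre and of its square;
* `ResCompat.isUnit`, `ResCompat.exists_extend_locAtCentre` — extension along `B ↦ locAtCentre B O`;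
* `ResCompat.of_eqOn_closure`, `ResCompat.exists_extend_chart` — DESCENT through a blow-up chart: a residue-compatible `Φ : S → L` killing a
  quasi-regular `x` extends to `S[x_j/x_i : j] → L` with PRESCRIBED residue-compatible values on the fractions (via the chart quotient
  `S[x/x_i]/(x_i) ≅ (S/(x))[T]`, `ChartRsop.closure_chartQuotient_X`).
-/

-- single-problem summit: the doubled namespace component `ResolutionOfSingularities` is forced
set_option linter.dupNamespace false

open scoped BigOperators

noncomputable section

namespace Summit.ResolutionOfSingularities.ResolutionOfSingularities.Theorems.SteerToricUnitExit

open IsLocalRing Literature.AlgebraicGeometry.Resolution MvPolynomial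
open Summit.ResolutionOfSingularities.ResolutionOfSingularities.Theorems.SwitchingDichotomy

variable {K : Type} [Field K]

open Classical in
/-- The residue of `u ∈ K` in the residue field `κ(O)` of the valuation ring (`0` if `u ∉ O`). [folklore] -/
def resK (O : ValuationSubring K) (u : K) : ResidueField O :=
  if h : u ∈ O then residue O ⟨u, h⟩ else 0

/-- On `O` the residue is the residue. [folklore] -/
theorem resK_of_mem (O : ValuationSubring K) {u : K} (h : u ∈ O) : resK O u = residue O ⟨u, h⟩ := by
  classical
  simp [resK, h]

/-- `ū = 0` iff `v(u) < 1`, for `u ∈ O`. [folklore] -/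
theorem resK_eq_zero_iff (O : ValuationSubring K) {u : K} (h : u ∈ O) : resK O u = 0 ↔ O.valuation u < 1 := by
  rw [resK_of_mem O h, residue_eq_zero_iff, ValuationSubring.valuation_lt_one_iff]

/-- The evaluation `A = κ(O)[Y_(u,i)] → κ(O)`, `Y_(u,i) ↦ ū`. [folklore] -/
def evalRes (O : ValuationSubring K) : MvPolynomial (K × ℕ) (ResidueField O) →ₐ[ResidueField O] ResidueField O :=
  aeval fun p => resK O p.1

/-- `ev (Y_(u,i)) = ū`. [folklore] -/
theorem evalRes_X (O : ValuationSubring K) (p : K × ℕ) : evalRes O (X p) = resK O p.1 := by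
  simp [evalRes]

/-- The prime `𝔭 = ker ev`. [folklore] -/
def kerRes (O : ValuationSubring K) : Ideal (MvPolynomial (K × ℕ) (ResidueField O)) :=
  RingHom.ker (evalRes O).toRingHom

/-- Membership in `𝔭` is vanishing under `ev`. [folklore] -/
theorem mem_kerRes_iff (O : ValuationSubring K) (a : MvPolynomial (K × ℕ) (ResidueField O)) :
    a ∈ kerRes O ↔ evalRes O a = 0 := RingHom.mem_ker

/-- `𝔭` is prime (a THEOREM, not an instance: statements about `L = A_𝔭` below take `[(kerRes O).IsPrime]`, supplied by
`haveI := kerRes_isPrime O`). [folklore] -/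
theorem kerRes_isPrime (O : ValuationSubring K) : (kerRes O).IsPrime :=
  RingHom.ker_isPrime _

/-- A variable `Y_(u,i)` with `u` a unit of `O` is not in `𝔭`. [folklore] -/
theorem X_not_mem_kerRes (O : ValuationSubring K) (p : K × ℕ) (hu : O.valuation p.1 = 1) :
    (X p : MvPolynomial (K × ℕ) (ResidueField O)) ∉ kerRes O := by
  have hmem : p.1 ∈ O := by rw [← O.valuation_le_one_iff]; exact hu.le
  rw [mem_kerRes_iff, evalRes_X, resK_eq_zero_iff O hmem, hu]; exact lt_irrefl _

/-! ## The local target `L = A_𝔭` and its evaluation -/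

/-- The evaluation extended to `L = A_𝔭` (elements off `𝔭` have non-zero, hence invertible, values). [folklore] -/
def evalResL (O : ValuationSubring K) [(kerRes O).IsPrime] : Localization.AtPrime (kerRes O) →+* ResidueField O :=
  IsLocalization.lift (M := (kerRes O).primeCompl) (g := (evalRes O).toRingHom) fun s =>
    isUnit_iff_ne_zero.mpr fun h => s.2 ((mem_kerRes_iff O s.1).mpr h)

/-- `ev_L` extends `ev`. [folklore] -/
theorem evalResL_algebraMap (O : ValuationSubring K) [(kerRes O).IsPrime] (a : MvPolynomial (K × ℕ) (ResidueField O)) :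
    evalResL O (algebraMap _ (Localization.AtPrime (kerRes O)) a) = evalRes O a :=
  IsLocalization.lift_eq _ a

/-- `x ∈ 𝔪_L` iff `ev_L x = 0`. [folklore] -/
theorem mem_maximalIdeal_iff_evalResL (O : ValuationSubring K) [(kerRes O).IsPrime] (x : Localization.AtPrime (kerRes O)) :
    x ∈ maximalIdeal (Localization.AtPrime (kerRes O)) ↔ evalResL O x = 0 := by
  obtain ⟨⟨a, s⟩, rfl⟩ := IsLocalization.mk'_surjective (kerRes O).primeCompl x
  rw [IsLocalization.AtPrime.mk'_mem_maximal_iff (Localization.AtPrime (kerRes O)) (kerRes O) a s]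
  have hspec := IsLocalization.mk'_spec (Localization.AtPrime (kerRes O)) a s
  have hs : evalRes O (s : MvPolynomial (K × ℕ) (ResidueField O)) ≠ 0 := fun h => s.2 ((mem_kerRes_iff O s.1).mpr h)
  have hev := congrArg (evalResL O) hspec
  rw [map_mul, evalResL_algebraMap, evalResL_algebraMap] at hev
  rw [mem_kerRes_iff]
  constructor
  · intro ha
    rw [ha] at hev
    exact (mul_eq_zero.mp hev).resolve_right hs
  · intro h0
    rw [h0, zero_mul] at hev
    exact hev.symm

/-! ## Residue-compatible maps -/

/-- `Φ : R → L` is RESIDUE-COMPATIBLE: `ev_L (Φ r)` is the residue of `r` in `κ(O)`. [folklore] -/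
def ResCompat (O : ValuationSubring K) [(kerRes O).IsPrime] (R : Subring K) (h : R ≤ O.toSubring)
    (Φ : R →+* Localization.AtPrime (kerRes O)) : Prop :=
  ∀ r : R, evalResL O (Φ r) = residue O ⟨(r : K), h r.2⟩

namespace ResCompat

variable {O : ValuationSubring K} [(kerRes O).IsPrime] {R : Subring K} {h : R ≤ O.toSubring}
  {Φ : R →+* Localization.AtPrime (kerRes O)}

/-- Transport of the centre: `Φ r ∈ 𝔪_L` iff `v(r) < 1`. [folklore] -/
theorem mem_maximalIdeal_iff (hΦ : ResCompat O R h Φ) (r : R) :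
    Φ r ∈ maximalIdeal (Localization.AtPrime (kerRes O)) ↔ O.valuation (r : K) < 1 := by
  rw [mem_maximalIdeal_iff_evalResL, hΦ r, residue_eq_zero_iff, ValuationSubring.valuation_lt_one_iff]

/-- Elements of value `1` go to units. [folklore] -/
theorem isUnit (hΦ : ResCompat O R h Φ) (r : R) (hv : O.valuation (r : K) = 1) : IsUnit (Φ r) := by
  by_contra hu
  have : Φ r ∈ maximalIdeal _ := (IsLocalRing.mem_maximalIdeal _).mpr hu
  rw [hΦ.mem_maximalIdeal_iff, hv] at this
  exact lt_irrefl _ this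

/-- Transport of the square of the centre: if `𝔮 ⊆ R` is the centre then `Φ(𝔮²) ⊆ 𝔪_L²`. [folklore] -/
theorem map_mem_sq (hΦ : ResCompat O R h Φ) {𝔮 : Ideal R} (h𝔮 : ∀ a : R, a ∈ 𝔮 → O.valuation (a : K) < 1) {x : R}
    (hx : x ∈ 𝔮 ^ 2) : Φ x ∈ maximalIdeal (Localization.AtPrime (kerRes O)) ^ 2 := by
  have hle : Ideal.map Φ 𝔮 ≤ maximalIdeal _ := by
    rw [Ideal.map_le_iff_le_comap]
    intro a ha
    exact (hΦ.mem_maximalIdeal_iff a).mpr (h𝔮 a ha)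
  have := Ideal.mem_map_of_mem Φ hx
  rw [Ideal.map_pow] at this
  exact Ideal.pow_right_mono hle 2 this

/-- **Extension along the localisation at the centre.** A residue-compatible `Φ : C → L` (`C ⊆ O`) extends to a residue-compatible
`Φ' : locAtCentre C O → L`. [folklore] -/
theorem exists_extend_locAtCentre {C : Subring K} (hC : C ≤ O.toSubring) (Φ : C →+* Localization.AtPrime (kerRes O))
    (hΦ : ResCompat O C hC Φ) :
    ∃ Φ' : locAtCentre C O →+* Localization.AtPrime (kerRes O),
      ResCompat O (locAtCentre C O) (locAtCentre_le hC) Φ' ∧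
      ∀ c : C, Φ' ⟨(c : K), le_locAtCentre C O c.2⟩ = Φ c := by
  haveI := isLocalization_locAtCentre hC
  have hunit : ∀ s : (subringCentre C O hC).primeCompl, IsUnit (Φ s) := fun s =>
    hΦ.isUnit _ (valuation_eq_one_of_not_mem_subringCentre hC s.2)
  refine ⟨IsLocalization.lift (M := (subringCentre C O hC).primeCompl) hunit, fun x => ?_, fun c =>
    IsLocalization.lift_eq (M := (subringCentre C O hC).primeCompl) hunit c⟩
  obtain ⟨⟨y, s⟩, rfl⟩ := IsLocalization.mk'_surjective (subringCentre C O hC).primeCompl x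
  have hspec := IsLocalization.mk'_spec (locAtCentre C O) y s
  have hs1 : O.valuation ((s : C) : K) = 1 := valuation_eq_one_of_not_mem_subringCentre hC s.2
  -- apply `ev_L ∘ Φ'` and `residue` to `mk' y s * s = y`
  have h1 := congrArg (fun t => evalResL O (IsLocalization.lift (M := (subringCentre C O hC).primeCompl) hunit t)) hspec
  simp only [map_mul, IsLocalization.lift_eq] at h1
  rw [hΦ, hΦ] at h1
  have h2 : residue O ⟨((IsLocalization.mk' (locAtCentre C O) y s : locAtCentre C O) : K), locAtCentre_le hC
      (IsLocalization.mk' (locAtCentre C O) y s).2⟩ * residue O ⟨((s : C) : K), hC (s : C).2⟩ =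
      residue O ⟨((y : C) : K), hC y.2⟩ := by
    rw [← map_mul]
    congr 1
    exact Subtype.ext (congrArg (fun t : locAtCentre C O => (t : K)) hspec)
  have hs0 : residue O ⟨((s : C) : K), hC (s : C).2⟩ ≠ 0 := by
    rw [Ne, residue_eq_zero_iff, ValuationSubring.valuation_lt_one_iff]
    change ¬ O.valuation ((s : C) : K) < 1
    rw [hs1]; exact lt_irrefl _
  exact mul_right_cancel₀ hs0 (h1.trans h2.symm)

/-- Residue-compatibility is checked on generators: two ring maps `C → κ(O)` agreeing on a generating set agree. [folklore] -/
theorem of_eqOn_closure {s : Set K} (hC : Subring.closure s ≤ O.toSubring)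
    (Φ : Subring.closure s →+* Localization.AtPrime (kerRes O))
    (hgen : ∀ (u : K) (hu : u ∈ s),
      evalResL O (Φ ⟨u, Subring.subset_closure hu⟩) = residue O ⟨u, hC (Subring.subset_closure hu)⟩) :
    ResCompat O (Subring.closure s) hC Φ := by
  -- the two ring maps `C → κ(O)`
  let f : Subring.closure s →+* ResidueField O := (evalResL O).comp Φ
  let g : Subring.closure s →+* ResidueField O := (residue O).comp (Subring.inclusion hC)
  intro r
  obtain ⟨r, hr⟩ := r
  change f ⟨r, hr⟩ = g ⟨r, hr⟩
  induction hr using Subring.closure_induction with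
  | mem u hu => exact hgen u hu
  | zero => change f 0 = g 0; rw [map_zero, map_zero]
  | one => change f 1 = g 1; rw [map_one, map_one]
  | add u w hu hw ihu ihw =>
    change f (⟨u, hu⟩ + ⟨w, hw⟩) = g (⟨u, hu⟩ + ⟨w, hw⟩); rw [map_add, map_add, ihu, ihw]
  | neg u hu ihu => change f (-⟨u, hu⟩) = g (-⟨u, hu⟩); rw [map_neg, map_neg, ihu]
  | mul u w hu hw ihu ihw =>
    change f (⟨u, hu⟩ * ⟨w, hw⟩) = g (⟨u, hu⟩ * ⟨w, hw⟩); rw [map_mul, map_mul, ihu, ihw]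

/-- **Descent through a blow-up chart.** `S ⊆ O` a subring, `x` a quasi-regular sequence in `S` with `x_i ≠ 0` and the chart
`C = S[x_j/x_i : j] ⊆ O`; a residue-compatible `Φ : S → L` KILLING every `x_j` extends to a residue-compatible `Φ' : C → L` taking
PRESCRIBED values `τ_j` on the fractions `x_j/x_i` (`j ≠ i`), subject only to `ev_L (τ_j) = (x_j/x_i)‾`.  Construction: `C → C/(x_i) ≅
(S/(x))[T_j] → L` (the chart quotient `ChartRsop.closure_chartQuotient_X` and `eval₂`).
[cite: StacksProject, Tag 0BIQ]; folklore. -/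
theorem exists_extend_chart {S : Subring K} (hS : S ≤ O.toSubring) {r : ℕ} (x : Fin r → S) (hqr : IsQuasiRegular x)
    (i : Fin r) (hxi : x i ≠ 0)
    (hC : Subring.closure ((S : Set K) ∪ Set.range fun j => ((x j : S) : K) / ((x i : S) : K)) ≤ O.toSubring)
    (Φ : S →+* Localization.AtPrime (kerRes O)) (hΦ : ResCompat O S hS Φ) (hx : ∀ j, Φ (x j) = 0)
    (τ : {j : Fin r // j ≠ i} → Localization.AtPrime (kerRes O))
    (hτ : ∀ j, evalResL O (τ j) = residue O ⟨((x j.1 : S) : K) / ((x i : S) : K), hC (ChartRsop.div_mem_closure_chart S x i j.1)⟩) :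
    ∃ Φ' : Subring.closure ((S : Set K) ∪ Set.range fun j => ((x j : S) : K) / ((x i : S) : K)) →+*
        Localization.AtPrime (kerRes O),
      ResCompat O _ hC Φ' ∧ (∀ s : S, Φ' ⟨(s : K), ChartRsop.le_closure_chart S x i s.2⟩ = Φ s) ∧
      ∀ j : {j : Fin r // j ≠ i}, Φ' ⟨((x j.1 : S) : K) / ((x i : S) : K), ChartRsop.div_mem_closure_chart S x i j.1⟩ = τ j := by
  classical
  obtain ⟨ψ, hψ, hψC, hψX⟩ := ChartRsop.closure_chartQuotient_X S x hqr i hxi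
  -- `Φ` kills `(x)`, so it factors through `S/(x)`
  have hker : ∀ a ∈ Ideal.span (Set.range x), Φ a = 0 := by
    intro a ha
    have : Ideal.span (Set.range x) ≤ RingHom.ker Φ := by
      rw [Ideal.span_le]; rintro _ ⟨j, rfl⟩; exact (RingHom.mem_ker).mpr (hx j)
    exact (RingHom.mem_ker).mp (this ha)
  let Φbar : S ⧸ Ideal.span (Set.range x) →+* Localization.AtPrime (kerRes O) := Ideal.Quotient.lift _ Φ hker
  let E : MvPolynomial {j : Fin r // j ≠ i} (S ⧸ Ideal.span (Set.range x)) →+* Localization.AtPrime (kerRes O) :=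
    MvPolynomial.eval₂Hom Φbar τ
  let e := RingEquiv.ofBijective ψ hψ
  let Φ' : Subring.closure ((S : Set K) ∪ Set.range fun j => ((x j : S) : K) / ((x i : S) : K)) →+*
      Localization.AtPrime (kerRes O) := E.comp (e.symm.toRingHom.comp (Ideal.Quotient.mk _))
  have hΦ'S : ∀ s : S, Φ' ⟨(s : K), ChartRsop.le_closure_chart S x i s.2⟩ = Φ s := by
    intro s
    change E (e.symm (Ideal.Quotient.mk _ _)) = _
    have : e.symm (Ideal.Quotient.mk _ ⟨(s : K), ChartRsop.le_closure_chart S x i s.2⟩) =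
        MvPolynomial.C (Ideal.Quotient.mk _ s) := by
      rw [RingEquiv.symm_apply_eq]; exact (hψC s).symm
    rw [this, MvPolynomial.coe_eval₂Hom, MvPolynomial.eval₂_C]
    exact Ideal.Quotient.lift_mk _ _ _
  have hΦ'X : ∀ j : {j : Fin r // j ≠ i},
      Φ' ⟨((x j.1 : S) : K) / ((x i : S) : K), ChartRsop.div_mem_closure_chart S x i j.1⟩ = τ j := by
    intro j
    change E (e.symm (Ideal.Quotient.mk _ _)) = _
    have : e.symm (Ideal.Quotient.mk _ ⟨((x j.1 : S) : K) / ((x i : S) : K), ChartRsop.div_mem_closure_chart S x i j.1⟩) =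
        MvPolynomial.X j := by
      rw [RingEquiv.symm_apply_eq]; exact (hψX j).symm
    rw [this, MvPolynomial.coe_eval₂Hom, MvPolynomial.eval₂_X]
  refine ⟨Φ', of_eqOn_closure hC Φ' ?_, hΦ'S, hΦ'X⟩
  rintro u (hu | ⟨j, rfl⟩)
  · -- generators from `S`
    rw [hΦ'S ⟨u, hu⟩]; exact hΦ ⟨u, hu⟩
  · -- the fractions
    by_cases hji : j = i
    · subst hji
      have h0 : ((x j : S) : K) ≠ 0 := fun h => hxi (Subtype.ext h)
      have h1 : (⟨((x j : S) : K) / ((x j : S) : K), Subring.subset_closure (Or.inr ⟨j, rfl⟩)⟩ :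
          Subring.closure ((S : Set K) ∪ Set.range fun j' => ((x j' : S) : K) / ((x j : S) : K))) = 1 :=
        Subtype.ext (div_self h0)
      have h2 : (⟨((x j : S) : K) / ((x j : S) : K), hC (Subring.subset_closure (Or.inr ⟨j, rfl⟩))⟩ : O) = 1 :=
        Subtype.ext (div_self h0)
      simp only [h1, h2, map_one]
    · simp only [hΦ'X ⟨j, hji⟩]; exact hτ ⟨j, hji⟩

end ResCompat

end Summit.ResolutionOfSingularities.ResolutionOfSingularities.Theorems.SteerToricUnitExit

end
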